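import Summits.ABC.IUTFork.Cor312UnitCountermodel
import Summits.ABC.IUTFork.Cor312PilotKummerCompatNonVacuity
import HarnessLib

/-!
# [IUTchIII] Cor. 3.12 — the UNIT-INDETERMINACY test model, IV: the POSITIVE side (T-c on the unit axis) — settings reading a
# bad-place datum, the unit P♭, and the T-c engine for an arbitrary candidate

Record file (D-0012; ONE model-data definition `uWithQDatum`, then proofs; no `Prop` fact) of the abc-iut cell, written by the
REPAIR branch's on-call kernel hand abc-iut-w5-d147 (gen 3) DOWNSTREAM of abc-iut-w4-d101's unit model (author lineage of the
countermodel of record; `Cor312UnitShells` p429139, `Cor312UnitThm311` p429309, `Cor312UnitCountermodel` — parts I–III), consumed BY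
NAME; TAKES NO SIDE on [IUTchIII] Cor. 3.12 or on any author. HOME/plan/repair/REPAIR-SPEC.md §3 (T-c) and RULINGS #3 (iii) («rows of
the shape "modulo torsion vs modulo (Ind2)" WAIT for the unit model»): part III is the unit-axis COUNTERMODEL (T-b object); THIS FILE is
the unit-axis POSITIVE family (T-c objects), the analogue of abc-iut-w5-d247's `NaiveWitness.withQDatum` / `linkIdSetting` over the
sign shells:

* §1 `uWithQDatum p qK hqK` — `uSetting p` with the q-pilot GLUE READING A BAD-PLACE DATUM `qK` through abc-iut-w4-d101's region operator
  `orbitRegion` (so the q-pin holds BY CONSTRUCTION); the Θ-side, the objects, the frame are part III's verbatim. For EVERY datum: the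
  three pins `uWithQDatum_pinnedRegions3`, `BridgeHyps`, `ThetaFinite`, `−|log(Θ)| = −(5/2)·log p`.
* §2 THE UNIT P♭ `uLinkId p` := the datum is the line-`0` splitting monoid itself (`(uLine p 0).Ψ`, the `u₀⁰`-transport of `Ψ`): its
  q-region is `B_{j²}`, `−|log(q)| = −(5/2)·log p < 0`, and the residual S (`PilotKummerIndRelated`), print's datum-level clause
  `PilotKummerCompat` (Φ = 1, m = 0 by part II's `uColumn_frobΨ`), the region / hull clauses, the (xi-f) `Licence` and the typed
  Statement ALL HOLD — non-vacuity of the positive chain on the unit axis (typed Thm. 3.11 with DISTINCT lines and an INFINITE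
  non-sign indeterminacy group, part II).
* §3 THE (T-c) ENGINE ON THE UNIT AXIS for an ARBITRARY candidate `H` (bound variable of the PR-1 arity):
  `satisfiable_on_units_of_holds_at_uLinkId` — `H` true at the unit P♭ ⊢ the SAT package (typed Thm. 3.11 ∧ MultiradialCompat ∧ KummerB
  ∧ BridgeHyps ∧ AbsLogQPos ∧ PinnedRegions3 ∧ H ∧ S ∧ PilotKummerCompat ∧ Statement, lines pairwise distinct, indeterminacy group not
  acting by signs); `satisfiable_on_units_of_datum_imp` — the same for every `H` implied by the datum clause (one `exact`).
HONEST SCOPE (as parts I–III): one place (`toyIndex`, `l⋆ = 2`); the datum-generated q-regions are P♭-type (q-datum tied to the Θ-datum),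
i.e. grade SAT0 on the unit axis; not a model of initial Θ-data. [claim: Mochizuki2012, status: disputed]
[cite: ScholzeStix2018, §2.2 pp. 9–10] Standard axioms; typed ≠ proved; instantiated ≠ endorsed.
-/

noncomputable section

namespace Summit.ABC.IUTFork.Cor312Vol.UnitWitness

open Set Thm311 Cor312 Cor312.Checks Cor312.IdentifiedNonVacuity NaiveWitness PinnedWitness Literature.IUT.LogThetaLattice

variable (p : ℕ) [hp : Fact p.Prime]

/-! ## 1. Settings over the unit situation whose q-pilot glue READS a bad-place datum -/

/-- **`uWithQDatum p qK hqK`** — abc-iut-w4-d101's unit setting `uSetting p` (part III: honest object side, Θ-glue reading the lgp-object,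
frame the `p`-adic balls, column `n = 0`) with the q-PILOT GLUE replaced by «the region `orbitRegion qK` of a bad-place Kummer datum `qK`»,
required to be a ball at every packet (`hqK`). With `qK :=` the line-`0` splitting monoid this is the unit P♭ (§2). MODEL DATA of a toy;
no claim. [claim: Mochizuki2012, status: disputed] -/
def uWithQDatum (qK : ∀ v : toyIndex.V, v ∈ toyIndex.Vbad → Set ((unitShells p).StarPacket v))
    (hqK : ∀ (j : toyIndex.Label) (vQ : toyIndex.VQ), ∃ k : ℤ, uBall p j vQ k = orbitRegion p qK j vQ) :
    Setting (uSituation p) :=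
  { uSetting p with
    qRegionOf := fun _ j vQ => orbitRegion p qK j vQ
    qRegion_mem := fun j vQ => by
      obtain ⟨k, hk⟩ := hqK j vQ
      show orbitRegion p qK j vQ ∈ (uFrame p j vQ).Hul
      rw [← hk]
      exact uBall_mem_hul p j vQ k
    qSupport_finite := fun _ => Set.toFinite _ }

section WithQDatum

variable (qK : ∀ v : toyIndex.V, v ∈ toyIndex.Vbad → Set ((unitShells p).StarPacket v))
  (hqK : ∀ (j : toyIndex.Label) (vQ : toyIndex.VQ), ∃ k : ℤ, uBall p j vQ k = orbitRegion p qK j vQ)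

/-- The column index is part III's (`0`). [folklore] -/
theorem uWithQDatum_n : (uWithQDatum p qK hqK).n = (uSetting p).n := rfl

/-- The Θ-pilot Kummer image at `(n, m)`, label `j`, is `B_{j²}` (part III, unchanged). [folklore] -/
theorem uWithQDatum_thetaRegion (m : ℤ) (j : toyIndex.Label) (vQ : toyIndex.VQ) :
    (uWithQDatum p qK hqK).thetaRegion m j vQ = uBall p j vQ (jsq j) :=
  uSetting_thetaRegion p m j vQ

/-- **The q-pin BY CONSTRUCTION**: the q-pilot region is `orbitRegion qK`. [folklore] -/
theorem uWithQDatum_qRegion (j : toyIndex.Label) (vQ : toyIndex.VQ) :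
    (uWithQDatum p qK hqK).qRegion j vQ = orbitRegion p qK j vQ := rfl

/-- The (Ind3)-enlarged Θ-region is `B_{j²}`. [folklore] -/
theorem uWithQDatum_thetaRegion3 (j : toyIndex.Label) (vQ : toyIndex.VQ) :
    (uWithQDatum p qK hqK).thetaRegion3 j vQ = uBall p j vQ (jsq j) :=
  uSetting_thetaRegion3 p j vQ

/-- The possible images of the Θ-pilot are `{B_{j²}}` (units fix balls; part III). [folklore] -/
theorem uWithQDatum_possibleImages (j : toyIndex.Label) (vQ : toyIndex.VQ) :
    (uWithQDatum p qK hqK).possibleImages j vQ = {uBall p j vQ (jsq j)} :=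
  uSetting_possibleImages p j vQ

/-- The hull of the union of the possible images is `B_{j²}`. [folklore] -/
theorem uWithQDatum_thetaHull (j : toyIndex.Label) (vQ : toyIndex.VQ) :
    (uWithQDatum p qK hqK).thetaHull j vQ = uBall p j vQ (jsq j) :=
  uSetting_thetaHull p j vQ

/-- "`−|log(Θ)|` is finite". [folklore] -/
theorem uWithQDatum_thetaFinite : (uWithQDatum p qK hqK).ThetaFinite :=
  uSetting_thetaFinite p

/-- `−|log(Θ)| = −(5/2)·log p`, whatever the q-datum (part III's number). [folklore] -/
theorem uWithQDatum_negLogTheta :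
    (uWithQDatum p qK hqK).negLogTheta = ((-(5 / 2) * Real.log p : ℝ) : WithTop ℝ) :=
  uSetting_negLogTheta p

/-- **All bridge hypotheses hold**, whatever the q-datum (Θ-side and frame only; part III's proof). [folklore] -/
theorem uWithQDatum_bridgeHyps : BridgeHyps (uWithQDatum p qK hqK) where
  mono := (uSetting_bridgeHyps p).mono
  image_adm := (uSetting_bridgeHyps p).image_adm
  image_fin := (uSetting_bridgeHyps p).image_fin
  hul_nonempty := (uSetting_bridgeHyps p).hul_nonempty
  theta_nonempty := (uSetting_bridgeHyps p).theta_nonempty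
  finite := uWithQDatum_thetaFinite p qK hqK

/-- **The Θ-pin (hρ) ∧ (pΘ) holds** for abc-iut-w4-d101's operator — equivariant under the WHOLE unit group (part III
`orbitRegion_equivariantU`), and the Θ-region is the region of every column Kummer image `frobΨ m`. [claim: Mochizuki2012, status: disputed] -/
theorem uWithQDatum_thetaPinned : ThetaPinned (uFull p).toLatticeSituation (uWithQDatum p qK hqK) (orbitRegion p) :=
  ⟨fun _ hΦ Ψ j vQ => orbitRegion_equivariantU p hΦ Ψ j vQ, fun m j vQ =>
    (uWithQDatum_thetaRegion p qK hqK m j vQ).trans (orbitRegion_frobΨ p m j vQ).symm⟩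

/-- **The q-pin (pq′) holds by construction.** [claim: Mochizuki2012, status: disputed] -/
theorem uWithQDatum_qPinned : QPinned (uFull p).toLatticeSituation (uWithQDatum p qK hqK) (orbitRegion p) qK := fun _ _ => rfl

/-- The Θ-pilot object is the lgp-object of exponent `1` (part III). [folklore] -/
theorem uWithQDatum_thetaPilot : (uWithQDatum p qK hqK).thetaPilot = (1 : ℤ) := uSetting_thetaPilot p

/-- The object-level link pin (pL) holds (identity of exponents, as in part III). [folklore] -/
theorem uWithQDatum_pilotLink : Thm311ToCor312.PilotLink (uWithQDatum p qK hqK) :=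
  ⟨Equiv.refl ℤ, by rw [uWithQDatum_thetaPilot]; rfl⟩

/-- **All three pins `PinnedRegions3` hold** for `(orbitRegion, qK)` at `uWithQDatum p qK hqK`. [claim: Mochizuki2012, status: disputed] -/
theorem uWithQDatum_pinnedRegions3 :
    PinnedRegions3 (uFull p).toLatticeSituation (uWithQDatum p qK hqK) (orbitRegion p) qK :=
  ⟨⟨uWithQDatum_thetaPinned p qK hqK, uWithQDatum_qPinned p qK hqK⟩, uWithQDatum_pilotLink p qK hqK⟩

/-- **Under the pins the residual is a property of the DATUM alone**: `PilotKummerIndRelated` at `uWithQDatum p qK hqK` ⟺ «`qK`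
generates the theta balls», `orbitRegion qK = B_{j²}` at every packet (regions are unit-blind: every possible image of the line datum
has region `B_{j²}`). [claim: Mochizuki2012, status: disputed] -/
theorem uWithQDatum_pilotKummerIndRelated_iff :
    PilotKummerIndRelated (uFull p).toLatticeSituation (uWithQDatum p qK hqK) (orbitRegion p) qK ↔
      ∀ (j : toyIndex.Label) (vQ : toyIndex.VQ), orbitRegion p qK j vQ = uBall p j vQ (jsq j) := by
  refine (reading3_iff_pilotKummerIndRelated (uFull p).toLatticeSituation (uWithQDatum p qK hqK) (orbitRegion p) qK
    (uColumn_kummerB p 0) ⟨uWithQDatum_thetaPinned p qK hqK, uWithQDatum_qPinned p qK hqK⟩).symm.trans ?_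
  refine forall_congr' fun j => forall_congr' fun vQ => ?_
  rw [uWithQDatum_possibleImages, Set.mem_singleton_iff]
  exact Iff.rfl

end WithQDatum

/-! ## 2. The unit P♭: the datum is the line-`0` splitting monoid -/

/-- The line-`0` splitting monoid generates the theta balls (part III `orbitRegion_uLine_zero`). [folklore] -/
theorem uLineZero_hul (j : toyIndex.Label) (vQ : toyIndex.VQ) :
    ∃ k : ℤ, uBall p j vQ k = orbitRegion p (uLine p 0).Ψ j vQ :=
  ⟨jsq j, (orbitRegion_uLine_zero p j vQ).symm⟩

/-- **The UNIT P♭** `uLinkId p` := `uWithQDatum` with datum the line-`0` splitting monoid `(uLine p 0).Ψ` (= the Kummer image of the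
Frobenius-like splitting monoid of every `(0, m)`, part II `uColumn_frobΨ`): the link-identified glue on the unit axis. An `abbrev`.
[claim: Mochizuki2012, status: disputed] -/
abbrev uLinkId : Setting (uSituation p) := uWithQDatum p (uLine p 0).Ψ (uLineZero_hul p)

/-- Its q-pilot region is `B_{j²}` — the Θ-pilot region. [folklore] -/
theorem uLinkId_qRegion (j : toyIndex.Label) (vQ : toyIndex.VQ) : (uLinkId p).qRegion j vQ = uBall p j vQ (jsq j) :=
  orbitRegion_uLine_zero p j vQ

/-- For ANY datum generating the theta balls (`orbitRegion qK = B_{j²}` everywhere): the local q-term at `(j, v_ℚ)` is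
`μ(B_{j²}) = −j²·log p`. [folklore] -/
theorem uWithQDatum_qLocal_of_generates
    (qK : ∀ v : toyIndex.V, v ∈ toyIndex.Vbad → Set ((unitShells p).StarPacket v))
    (hqK : ∀ (j : toyIndex.Label) (vQ : toyIndex.VQ), ∃ k : ℤ, uBall p j vQ k = orbitRegion p qK j vQ)
    (hgen : ∀ (j : toyIndex.Label) (vQ : toyIndex.VQ), orbitRegion p qK j vQ = uBall p j vQ (jsq j))
    (j : toyIndex.Label) (vQ : toyIndex.VQ) : (uWithQDatum p qK hqK).qLocal j vQ = -(jsq j : ℝ) * Real.log p := by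
  show (uLine p 0).logvol j vQ ((uWithQDatum p qK hqK).qRegion j vQ) = _
  rw [uWithQDatum_qRegion, hgen, uLine_logvol_uBall]

/-- … its «`−|log(q)|`» is `−(5/2)·log p` (`(μ(B_1) + μ(B_4))/2`) … [folklore] -/
theorem uWithQDatum_negLogQ_of_generates
    (qK : ∀ v : toyIndex.V, v ∈ toyIndex.Vbad → Set ((unitShells p).StarPacket v))
    (hqK : ∀ (j : toyIndex.Label) (vQ : toyIndex.VQ), ∃ k : ℤ, uBall p j vQ k = orbitRegion p qK j vQ)
    (hgen : ∀ (j : toyIndex.Label) (vQ : toyIndex.VQ), orbitRegion p qK j vQ = uBall p j vQ (jsq j)) :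
    (uWithQDatum p qK hqK).negLogQ = -(5 / 2) * Real.log p := by
  unfold Setting.negLogQ
  have h : (fun i : Fin toyIndex.lstar => ∑ᶠ vQ : toyIndex.VQ, (uWithQDatum p qK hqK).qLocal (Setting.labelSucc i) vQ) =
      fun i => -(jsq (Setting.labelSucc i) : ℝ) * Real.log p := by
    funext i
    rw [finsum_unique, uWithQDatum_qLocal_of_generates p qK hqK hgen]
  rw [h]
  show (∑ i : Fin 2, -(jsq (Setting.labelSucc i) : ℝ) * Real.log p) / ((2 : ℕ) : ℝ) = _
  rw [Fin.sum_univ_two]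
  show (-((((((0 : Fin 2).succ : Fin 3) : ℕ) ^ 2 : ℕ) : ℤ) : ℝ) * Real.log p +
      -((((((1 : Fin 2).succ : Fin 3) : ℕ) ^ 2 : ℕ) : ℤ) : ℝ) * Real.log p) / ((2 : ℕ) : ℝ) = _
  norm_num
  ring

/-- … so "`|log(q)| > 0`" there, and the typed Statement HOLDS WITH EQUALITY (`−|log(Θ)| = −|log(q)| = −(5/2)·log p`). [folklore] -/
theorem uWithQDatum_absLogQPos_statement_of_generates
    (qK : ∀ v : toyIndex.V, v ∈ toyIndex.Vbad → Set ((unitShells p).StarPacket v))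
    (hqK : ∀ (j : toyIndex.Label) (vQ : toyIndex.VQ), ∃ k : ℤ, uBall p j vQ k = orbitRegion p qK j vQ)
    (hgen : ∀ (j : toyIndex.Label) (vQ : toyIndex.VQ), orbitRegion p qK j vQ = uBall p j vQ (jsq j)) :
    (uWithQDatum p qK hqK).AbsLogQPos ∧ (uWithQDatum p qK hqK).Statement ∧
      (uWithQDatum p qK hqK).negLogTheta = ((uWithQDatum p qK hqK).negLogQ : WithTop ℝ) := by
  have hq := uWithQDatum_negLogQ_of_generates p qK hqK hgen
  have hΘ := uWithQDatum_negLogTheta p qK hqK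
  have hlog : 0 < Real.log p := Real.log_pos (by exact_mod_cast hp.out.one_lt)
  refine ⟨?_, ⟨by rw [hΘ]; exact WithTop.coe_ne_top, ?_⟩, by rw [hΘ, hq]⟩
  · show (uWithQDatum p qK hqK).negLogQ < 0
    rw [hq]; linarith
  · rw [hΘ, hq]

/-- Its local q-term at `(j, v_ℚ)` is `μ(B_{j²}) = −j²·log p`. [folklore] -/
theorem uLinkId_qLocal (j : toyIndex.Label) (vQ : toyIndex.VQ) : (uLinkId p).qLocal j vQ = -(jsq j : ℝ) * Real.log p :=
  uWithQDatum_qLocal_of_generates p _ (uLineZero_hul p) (orbitRegion_uLine_zero p) j vQ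

/-- **`−|log(q)| = −(5/2)·log p`** at the unit P♭ (`(μ(B_1) + μ(B_4))/2`). [folklore] -/
theorem uLinkId_negLogQ : (uLinkId p).negLogQ = -(5 / 2) * Real.log p :=
  uWithQDatum_negLogQ_of_generates p _ (uLineZero_hul p) (orbitRegion_uLine_zero p)

/-- "`|log(q)| > 0`" at the unit P♭. [folklore] -/
theorem uLinkId_absLogQPos : (uLinkId p).AbsLogQPos :=
  (uWithQDatum_absLogQPos_statement_of_generates p _ (uLineZero_hul p) (orbitRegion_uLine_zero p)).1

/-- **The residual S HOLDS at the unit P♭** (its datum generates `B_{j²}`). [claim: Mochizuki2012, status: disputed] -/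
theorem uLinkId_pilotKummerIndRelated :
    PilotKummerIndRelated (uFull p).toLatticeSituation (uLinkId p) (orbitRegion p) (uLine p 0).Ψ :=
  (uWithQDatum_pilotKummerIndRelated_iff p (uLine p 0).Ψ (uLineZero_hul p)).2 (orbitRegion_uLine_zero p)

/-- **Print's datum-level clause `PilotKummerCompat` HOLDS at the unit P♭** (Φ = 1, m = 0: the datum IS the column-`0` Kummer image,
part II `uColumn_frobΨ`). [claim: Mochizuki2012, status: disputed] -/
theorem uLinkId_pilotKummerCompat : PilotKummerCompat (uFull p).toLatticeSituation (uLinkId p) (uLine p 0).Ψ :=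
  pilotKummerCompat_of_eq_frobΨ (uFull p).toLatticeSituation (uLinkId p) (uLine p 0).Ψ 0 fun v hv =>
    (uColumn_frobΨ p 0 0 v hv).symm

/-- The REGION-level clause holds there. [claim: Mochizuki2012, status: disputed] -/
theorem uLinkId_pilotKummerCompatRegion :
    PilotKummerCompatRegion (uFull p).toLatticeSituation (uLinkId p) (orbitRegion p) (uLine p 0).Ψ :=
  pilotKummerCompatRegion_of_pilotKummerCompat _ _ _ _ (uWithQDatum_thetaPinned p (uLine p 0).Ψ (uLineZero_hul p)).1 (uLinkId_pilotKummerCompat p)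

/-- The HULL-level clause holds there. [claim: Mochizuki2012, status: disputed] -/
theorem uLinkId_pilotKummerCompatHull :
    PilotKummerCompatHull (uFull p).toLatticeSituation (uLinkId p) (orbitRegion p) (uLine p 0).Ψ :=
  pilotKummerCompatHull_of_region _ _ _ _ (uWithQDatum_thetaPinned p (uLine p 0).Ψ (uLineZero_hul p)) (uLinkId_pilotKummerCompatRegion p)

/-- **The typed Statement of Cor. 3.12 HOLDS at the unit P♭** — `statement_of_pilotKummerCompat` FIRES on the unit axis.
[claim: Mochizuki2012, status: disputed] -/
theorem uLinkId_statement : (uLinkId p).Statement :=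
  statement_of_pilotKummerCompat _ _ (orbitRegion p) _ (uWithQDatum_bridgeHyps p (uLine p 0).Ψ (uLineZero_hul p)) (uWithQDatum_pinnedRegions3 p (uLine p 0).Ψ (uLineZero_hul p))
    (uLinkId_pilotKummerCompat p)

/-- … and the (xi-f) `Licence`. [claim: Mochizuki2012, status: disputed] -/
theorem uLinkId_licence : Thm311ToCor312.Licence (uLinkId p) :=
  licence_of_pilotKummerCompatHull _ _ _ _ (uWithQDatum_qPinned p (uLine p 0).Ψ (uLineZero_hul p)) (uLinkId_pilotKummerCompatHull p)

/-- The Statement is ATTAINED: `−|log(Θ)| = −|log(q)|` there. [folklore] -/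
theorem uLinkId_statement_attained : (uLinkId p).negLogTheta = ((uLinkId p).negLogQ : WithTop ℝ) := by
  rw [uWithQDatum_negLogTheta, uLinkId_negLogQ]

/-! ## 3. The (T-c) engine on the unit axis, for an ARBITRARY candidate -/

section Engine

variable (H : ∀ {T : ThetaIndex} (S : LatticeSituation T) (P : Cor312.Setting S.toSituation),
    ((∀ v : T.V, v ∈ T.Vbad → Set (S.L.StarPacket v)) → ∀ (j : T.Label) (vQ : T.VQ), Set (S.L.Packet j vQ)) →
    (∀ v : T.V, v ∈ T.Vbad → Set (S.L.StarPacket v)) → Prop)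

/-- **(T-c) ON THE UNIT AXIS**: a candidate TRUE at the unit P♭ is jointly satisfiable with the typed Thm. 3.11 (i)∧(ii)∧(iii) (lines
PAIRWISE DISTINCT, `MultiradialCompat` through a genuine (Ind2)-move), Thm. 3.11 (ii) (b) for the column, every bridge hypothesis,
`|log(q)| > 0`, the three pins, the residual S, print's datum clause and the typed Statement — in a model whose indeterminacy group does
NOT act by signs. [claim: Mochizuki2012, status: disputed] -/
theorem satisfiable_on_units_of_holds_at_uLinkId
    (h : H (uFull p).toLatticeSituation (uLinkId p) (orbitRegion p) (uLine p 0).Ψ) :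
    ∃ (T : ThetaIndex) (F : FullSituation T) (P : Cor312.Setting F.toLatticeSituation.toSituation)
      (ρ : (∀ v : T.V, v ∈ T.Vbad → Set (F.L.StarPacket v)) → ∀ (j : T.Label) (vQ : T.VQ), Set (F.L.Packet j vQ))
      (qK : ∀ v : T.V, v ∈ T.Vbad → Set (F.L.StarPacket v)),
      F.Statement ∧ F.MultiradialCompat ∧ (F.col P.n).KummerB (F.D P.n) ∧ BridgeHyps P ∧ P.AbsLogQPos ∧
        PinnedRegions3 F.toLatticeSituation P ρ qK ∧ H F.toLatticeSituation P ρ qK ∧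
        PilotKummerIndRelated F.toLatticeSituation P ρ qK ∧ PilotKummerCompat F.toLatticeSituation P qK ∧ P.Statement ∧
        (∀ n n' : ℤ, F.D n = F.D n' → n = n') ∧
        (∃ Φ ∈ Setting.indGroup F.toSituation, ∃ (j : T.Label) (vQ : T.VQ) (x : F.L.Packet j vQ),
          Φ j vQ x ≠ x ∧ Φ j vQ x ≠ -x) :=
  ⟨toyIndex, uFull p, uLinkId p, orbitRegion p, (uLine p 0).Ψ, uFull_statement p, u_multiradialCompat p, uColumn_kummerB p 0,
    uWithQDatum_bridgeHyps p (uLine p 0).Ψ (uLineZero_hul p), uLinkId_absLogQPos p,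
    uWithQDatum_pinnedRegions3 p (uLine p 0).Ψ (uLineZero_hul p), h, uLinkId_pilotKummerIndRelated p,
    uLinkId_pilotKummerCompat p, uLinkId_statement p, uFull_lines_distinct p, indGroup_not_by_signs p⟩

include p in
/-- **(T-c) on the unit axis for every candidate IMPLIED BY THE DATUM CLAUSE** (one `exact`). [claim: Mochizuki2012, status: disputed] -/
theorem satisfiable_on_units_of_datum_imp
    (hC : ∀ {T : ThetaIndex} (S : LatticeSituation T) (P : Cor312.Setting S.toSituation)
      (ρ : (∀ v : T.V, v ∈ T.Vbad → Set (S.L.StarPacket v)) → ∀ (j : T.Label) (vQ : T.VQ), Set (S.L.Packet j vQ))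
      (qK : ∀ v : T.V, v ∈ T.Vbad → Set (S.L.StarPacket v)), PilotKummerCompat S P qK → H S P ρ qK) :
    ∃ (T : ThetaIndex) (F : FullSituation T) (P : Cor312.Setting F.toLatticeSituation.toSituation)
      (ρ : (∀ v : T.V, v ∈ T.Vbad → Set (F.L.StarPacket v)) → ∀ (j : T.Label) (vQ : T.VQ), Set (F.L.Packet j vQ))
      (qK : ∀ v : T.V, v ∈ T.Vbad → Set (F.L.StarPacket v)),
      F.Statement ∧ F.MultiradialCompat ∧ (F.col P.n).KummerB (F.D P.n) ∧ BridgeHyps P ∧ P.AbsLogQPos ∧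
        PinnedRegions3 F.toLatticeSituation P ρ qK ∧ H F.toLatticeSituation P ρ qK ∧
        PilotKummerIndRelated F.toLatticeSituation P ρ qK ∧ PilotKummerCompat F.toLatticeSituation P qK ∧ P.Statement ∧
        (∀ n n' : ℤ, F.D n = F.D n' → n = n') ∧
        (∃ Φ ∈ Setting.indGroup F.toSituation, ∃ (j : T.Label) (vQ : T.VQ) (x : F.L.Packet j vQ),
          Φ j vQ x ≠ x ∧ Φ j vQ x ≠ -x) :=
  satisfiable_on_units_of_holds_at_uLinkId p H (hC _ _ _ _ (uLinkId_pilotKummerCompat p))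

end Engine

end Summit.ABC.IUTFork.Cor312Vol.UnitWitness

end
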